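import Literature.NumberTheory.Transcendental.KaehlerIdentityLaplacianCorollaries
import Literature.NumberTheory.Transcendental.KaehlerHodgeDecompositionProofs
import Literature.Geometry.Kaehler.ManifoldFormsPullback
import Literature.Geometry.Kaehler.KaehlerProofs
import Literature.Geometry.Manifold.OpenSubmanifoldTangent
import HarnessLib

/-!
# The Kähler identity `Δ_d = 2Δ_∂̄` and its corollaries, discharged without a separation axiom

Trunk **T-KAEHLER** (`NumberTheory/Transcendental`), theorems-only companion of
`KaehlerIdentityLambdaProofs.lean` / `KaehlerIdentityLaplacianCorollaries.lean`. Those files prove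
the named fact
`Literature.NumberTheory.Transcendental.cHodgeLaplacian_eq_two_smul_dolbeaultLaplacian_of_isManifold_complex g o`
of `KaehlerHodge.lean` (Voisin (2002), §6.1.2, Thm. 6.7: "Let `(X, ω)` be a Kähler manifold … the
Laplacians `Δ_∂`, `Δ_∂̄`, `Δ_d` satisfy `Δ_∂ = Δ_∂̄ = ½ Δ_d`"; Huybrechts (2005), Prop. 3.1.12 (iii))
and its corollaries **under `[T2Space M]`** only — the osculation proof of Voisin's Prop. 6.5 uses
smooth bump functions — and record (module docstring of `KaehlerIdentityLambdaProofs.lean`, *Why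
`[T2Space M]`*): "the identity being local it stays true there, but a proof would restrict to
Hausdorff chart domains (forms on open submanifolds), which is not attempted. Hence this file does
not declare `…_holds`".

This file carries out exactly that localisation and declares the discharges

* `cHodgeLaplacian_eq_two_smul_dolbeaultLaplacian_of_isManifold_complex_holds` (`Δ_d = 2Δ_∂̄`),
* `dolbeaultLaplacian_eq_delLaplacian_of_isManifold_complex_holds` (`Δ_∂̄ = Δ_∂`),
* `typeComponent_mem_charmonicForms_of_isManifold_complex_holds`,
  `typeComponent_mem_harmonicForms_of_isManifold_complex_holds` (`Δ_d` preserves types),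
* `dolbeaultHarmonicForms_le_charmonicForms_of_isManifold_complex_holds` (`ℋ^{p,q}_∂̄ ⊆ ℋᵏ_d`),
* `dolbeaultHarmonicForms_conj_of_isManifold_complex_holds` (conjugation swaps `ℋ^{p,q}`, `ℋ^{q,p}`),

verbatim, for every complex manifold `M` (holomorphic atlas, no separation axiom), every smooth
metric `g` and orientation family `o`, in all degrees; the five corollaries are the tree's glue
theorems (`KaehlerHodgeDelLaplacianGlueProofs`, `KaehlerHodgeTypeProofs`,
`KaehlerHodgeTypeComponentProofs`, `KaehlerHodgeHarmonicFact`, `KaehlerHodgeConjFact`) fed the first.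

## The localisation (Voisin, §6.1.1: "it suffices to check the identity at a point")

All operators involved are local: `d` is natural under the inclusion `ι : U → M` of an open
submanifold, whose differential is the identity (`Literature.Geometry.Kaehler.mextDeriv_pullback_subtypeVal_apply`,
Warner (1983), Prop. 2.23; Lee (2013), Prop. 3.9: `T_p U = T_p M`), and `⋆`, the type projections
`α ↦ α^{p,q}` and scalars act pointwise. For `x ∈ M` let `U` be the domain of the chart at `x`, an open
submanifold of `M` which IS Hausdorff (it is homeomorphic to the chart's target in `E`). The metric
restricts to a smooth metric `g|_U` on `U` (O'Neill (1983), Ch. 2, pp. 36–37, Ch. 3, p. 57: tensor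
fields restrict to open sets — the tree's `OpenSubmanifold.contMDiff_bilinSection`), Kähler if `g` is
(`ω_{g|_U} = ω_g|_U`, `d(ω|_U) = (dω)|_U = 0`); forms restrict to smooth forms; and for a smooth `α`

  `(Δ_d α)|_U = Δ_d (α|_U)`, `(Δ_∂̄ α)|_U = Δ_∂̄ (α|_U)`

pointwise on `U` (`cHodgeLaplacian_restrict`, `dolbeaultLaplacian_restrict`). The `[T2Space U]`
instance of the tree's theorem
`cHodgeLaplacian_eq_two_smul_dolbeaultLaplacian_of_isManifold_complex_of_t2Space` then gives the
identity at `x`. Everything is proved; one auxiliary definition (`restrictMetric`, the induced metric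
on an open submanifold, with body); no named fact is introduced, six are discharged.

## References

* C. Voisin, *Hodge Theory and Complex Algebraic Geometry I*, CUP (2002), §6.1.1 Prop. 6.5,
  Lemma 6.6; §6.1.2 Thm. 6.7, Cor. 6.9, Cor. 6.10; §6.1.3 Cor. 6.12. [Voisin2002]
* D. Huybrechts, *Complex Geometry. An Introduction*, Springer (2005), Prop. 3.1.12,
  Prop. 3.2.6, Rem. 3.2.7. [Huybrechts2005]
* B. O'Neill, *Semi-Riemannian Geometry*, Academic Press (1983), Ch. 2, pp. 36–37; Ch. 3, p. 57
  (induced metric tensor on an open submanifold). [ONeillSemiRiemannian1983]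
* F. W. Warner, *Foundations of Differentiable Manifolds and Lie Groups*, GTM 94 (1983), Prop. 2.23.
  [WarnerGTM94]
* J. M. Lee, *Introduction to Smooth Manifolds*, 2nd ed., GTM 218 (2013), Example 1.26, Prop. 3.9.
-/

noncomputable section

open scoped Manifold ContDiff Topology
open Bundle Module TopologicalSpace Set Literature.Geometry.Kaehler

namespace Literature.NumberTheory.Transcendental

/-! ### The induced metric on an open submanifold -/

section OpenSubmanifoldMetric

variable {EB : Type*} [NormedAddCommGroup EB] [NormedSpace ℝ EB] {HB : Type*} [TopologicalSpace HB]
  {IB : ModelWithCorners ℝ EB HB} {n' : WithTop ℕ∞} {X : Type*} [TopologicalSpace X]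
  [ChartedSpace HB X] [IsManifold IB ∞ X]
  (g : ContMDiffRiemannianMetric IB n' EB (fun x : X ↦ TangentSpace IB x)) (U : Opens X)

/-- **The induced (`C^n`) Riemannian metric `g|_U` on an open submanifold** `U ⊆ X` of a manifold
with a `C^n` Riemannian metric `g` on its tangent bundle: `(g|_U)_u = g_u` on `T_u U = T_u X`
(O'Neill (1983), Ch. 3, p. 57, the induced metric tensor `j^*(g)` of a submanifold; its smoothness
is the restriction of smooth tensor fields to open sets, Ch. 2, pp. 36–37 — the tree's
`OpenSubmanifold.contMDiff_bilinSection`). Any `C^∞` manifold with corners, any smoothness exponent of the metric.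
[cite: ONeillSemiRiemannian1983, Ch. 3, p. 57; Ch. 2, pp. 36–37] -/
def restrictMetric :
    ContMDiffRiemannianMetric IB n' EB (fun u : U ↦ TangentSpace IB u) where
  inner u := g.inner u.1
  symm u := g.symm u.1
  pos u := g.pos u.1
  isVonNBounded u := g.isVonNBounded u.1
  contMDiff := Literature.Geometry.Manifold.OpenSubmanifold.contMDiff_bilinSection g.contMDiff U

/-- The induced metric is `g` read on `U`: `(g|_U).inner u = g.inner ↑u` (by definition).
[cite: ONeillSemiRiemannian1983, Ch. 3, p. 57] -/
@[simp]
theorem restrictMetric_inner (u : U) : (restrictMetric g U).inner u = g.inner u.1 := rfl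

end OpenSubmanifoldMetric

/-! ### Restriction of forms to an open submanifold of a complex manifold -/

section Restrict

variable {E : Type*} [NormedAddCommGroup E] [NormedSpace ℂ E]
  {M : Type*} [TopologicalSpace M] [ChartedSpace E M] {k m : ℕ}
  [FiniteDimensional ℂ E] {n : ℕ} [Fact (finrank ℝ E = n)]
  [IsManifold 𝓘(ℂ, E) ω M] [IsManifold 𝓘(ℝ, E) ∞ M]
  (g : ContMDiffRiemannianMetric 𝓘(ℝ, E) ∞ E (fun x : M ↦ TangentSpace 𝓘(ℝ, E) x))
  (o : (x : M) → Orientation ℝ (TangentSpace 𝓘(ℝ, E) x) (Fin n))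
  (U : Opens M)

/-! ### Restriction of forms and of the operators `d`, `⋆`, `α ↦ α^{p,q}`, `∂`, `∂̄`, `δ`, `∂̄*` -/

omit [FiniteDimensional ℂ E] [IsManifold 𝓘(ℂ, E) ω M] [IsManifold 𝓘(ℝ, E) ∞ M] in
/-- The restriction `α|_U = (u ↦ α ↑u)` of a form to an open submanifold is its pull-back along the
inclusion (`T_u U = T_u M`, the inclusion has identity differential; Lee (2013), Prop. 3.9).
[cite: WarnerGTM94, 2.22] -/
theorem pullback_subtypeVal_eq {F : Type*} [NormedAddCommGroup F] [NormedSpace ℝ F] {l : ℕ}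
    (β : MForm 𝓘(ℝ, E) M F l) :
    β.pullback 𝓘(ℝ, E) (Subtype.val : U → M) = (fun u : U ↦ β u.1 : MForm 𝓘(ℝ, E) U F l) :=
  funext fun u ↦ ContinuousAlternatingMap.ext fun v ↦ MForm.pullback_subtypeVal_apply β u v

omit [FiniteDimensional ℂ E] [IsManifold 𝓘(ℂ, E) ω M] in
/-- **Smooth forms restrict to smooth forms** on an open submanifold (Warner (1983), 2.22, for the
`C^∞` inclusion `U → M`). [cite: WarnerGTM94, 2.22] -/
theorem isSmoothForm_restrict {F : Type*} [NormedAddCommGroup F] [NormedSpace ℝ F] {l : ℕ}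
    {β : MForm 𝓘(ℝ, E) M F l} (hβ : IsSmoothForm β) :
    IsSmoothForm (I := 𝓘(ℝ, E)) (fun u : U ↦ β u.1 : MForm 𝓘(ℝ, E) U F l) := by
  rw [← pullback_subtypeVal_eq U β]
  exact hβ.pullback_subtypeVal

omit [FiniteDimensional ℂ E] [IsManifold 𝓘(ℂ, E) ω M] in
/-- **`d` commutes with restriction to an open submanifold** on smooth forms:
`d(α|_U) = (dα)|_U` (Warner (1983), Prop. 2.23, naturality of `d` for the inclusion, whose
differential is the identity). [cite: WarnerGTM94, Prop. 2.23] -/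
theorem mextDeriv_restrict {F : Type*} [NormedAddCommGroup F] [NormedSpace ℝ F] {l : ℕ}
    {β : MForm 𝓘(ℝ, E) M F l} (hβ : IsSmoothForm β) :
    mextDeriv (I := 𝓘(ℝ, E)) (fun u : U ↦ β u.1 : MForm 𝓘(ℝ, E) U F l) =
      fun u : U ↦ mextDeriv β u.1 := by
  rw [← pullback_subtypeVal_eq U β]
  exact funext fun u ↦ ContinuousAlternatingMap.ext fun v ↦
    mextDeriv_pullback_subtypeVal_apply (hβ (u : M)) v

omit [FiniteDimensional ℂ E] [IsManifold 𝓘(ℂ, E) ω M] [IsManifold 𝓘(ℝ, E) ∞ M] in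
/-- The type projection `α ↦ α^{p,q}` is pointwise, hence commutes with restriction:
`(α|_U)^{p,q} = (α^{p,q})|_U` (Voisin (2002), §2.3.1). [cite: Voisin2002, §2.3.1] -/
theorem typeComponent_restrict {l : ℕ} (β : MForm 𝓘(ℝ, E) M ℂ l) (p q : ℕ) :
    MForm.typeComponent p q (fun u : U ↦ β u.1 : MForm 𝓘(ℝ, E) U ℂ l) =
      fun u : U ↦ (β.typeComponent p q) u.1 := by
  unfold MForm.typeComponent
  split_ifs <;> rfl

omit [FiniteDimensional ℂ E] in
/-- **`∂̄` commutes with restriction to an open submanifold** on smooth forms: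
`∂̄(α|_U) = (∂̄α)|_U` (`∂̄ = ∑ (d α^{p,q})^{p,q+1}`, each ingredient commutes).
[cite: Voisin2002, §2.3.3] -/
theorem dolbeaultBar_restrict {l : ℕ} {β : MForm 𝓘(ℝ, E) M ℂ l} (hβ : IsSmoothForm β) :
    dolbeaultBar (fun u : U ↦ β u.1 : MForm 𝓘(ℝ, E) U ℂ l) = fun u : U ↦ dolbeaultBar β u.1 := by
  unfold dolbeaultBar
  funext u
  simp only [Finset.sum_apply]
  refine Finset.sum_congr rfl fun pq _ ↦ ?_
  rw [typeComponent_restrict U β, mextDeriv_restrict U (hβ.typeComponent pq.1 pq.2),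
    typeComponent_restrict U (mextDeriv (β.typeComponent pq.1 pq.2))]

omit [FiniteDimensional ℂ E] in
/-- **`∂` commutes with restriction to an open submanifold** on smooth forms:
`∂(α|_U) = (∂α)|_U`. [cite: Voisin2002, §2.3.3] -/
theorem dolbeault_restrict {l : ℕ} {β : MForm 𝓘(ℝ, E) M ℂ l} (hβ : IsSmoothForm β) :
    dolbeault (fun u : U ↦ β u.1 : MForm 𝓘(ℝ, E) U ℂ l) = fun u : U ↦ dolbeault β u.1 := by
  unfold dolbeault
  funext u
  simp only [Finset.sum_apply]
  refine Finset.sum_congr rfl fun pq _ ↦ ?_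
  rw [typeComponent_restrict U β, mextDeriv_restrict U (hβ.typeComponent pq.1 pq.2),
    typeComponent_restrict U (mextDeriv (β.typeComponent pq.1 pq.2))]

omit [IsManifold 𝓘(ℂ, E) ω M] in
/-- **The Hodge star is pointwise, hence commutes with restriction** to an open submanifold
carrying the induced metric and orientation: `⋆(α|_U) = (⋆α)|_U` (Warner (1983), 4.10 (6): `⋆`
acts fibrewise). [cite: WarnerGTM94, 4.10 (6), p. 150] -/
theorem cHodgeStar_restrict {l l' : ℕ} (h : l + l' = n) (β : MForm 𝓘(ℝ, E) M ℂ l) :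
    letI : RiemannianBundle (fun x : M ↦ TangentSpace 𝓘(ℝ, E) x) := ⟨g.toRiemannianMetric⟩
    letI : RiemannianBundle (fun u : U ↦ TangentSpace 𝓘(ℝ, E) u) :=
      ⟨(restrictMetric g U).toRiemannianMetric⟩
    MForm.cHodgeStar (fun u : U ↦ o u.1) h (fun u : U ↦ β u.1 : MForm 𝓘(ℝ, E) U ℂ l) =
      fun u : U ↦ MForm.cHodgeStar o h β u.1 :=
  rfl

omit [FiniteDimensional ℂ E] [IsManifold 𝓘(ℂ, E) ω M] in
/-- **The Riemannian volume form of the induced metric and orientation is the restriction of the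
volume form** (pointwise; Warner (1983), 4.10, p. 150). [cite: WarnerGTM94, 4.10, p. 150] -/
theorem riemannianVolumeForm_restrict :
    letI : RiemannianBundle (fun x : M ↦ TangentSpace 𝓘(ℝ, E) x) := ⟨g.toRiemannianMetric⟩
    letI : RiemannianBundle (fun u : U ↦ TangentSpace 𝓘(ℝ, E) u) :=
      ⟨(restrictMetric g U).toRiemannianMetric⟩
    riemannianVolumeForm (I := 𝓘(ℝ, E)) (fun u : U ↦ o u.1) =
      fun u : U ↦ riemannianVolumeForm (I := 𝓘(ℝ, E)) o u.1 :=
  rfl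

omit [IsManifold 𝓘(ℂ, E) ω M] in
/-- **The codifferential commutes with restriction** on smooth forms: `δ(α|_U) = (δα)|_U`
(`δ = ±⋆d⋆`; `⋆` pointwise, `d` natural, `⋆α` smooth for a smooth metric and an orientation with
smooth volume form — Warner (1983), 6.1 (2), p. 220). [cite: WarnerGTM94, 6.1 (2), p. 220] -/
theorem cmcoderiv_restrict {l l' : ℕ} (h : (l + 1) + l' = n) {β : MForm 𝓘(ℝ, E) M ℂ (l + 1)}
    (hβ : IsSmoothForm β) :
    letI : RiemannianBundle (fun x : M ↦ TangentSpace 𝓘(ℝ, E) x) := ⟨g.toRiemannianMetric⟩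
    letI : RiemannianBundle (fun u : U ↦ TangentSpace 𝓘(ℝ, E) u) :=
      ⟨(restrictMetric g U).toRiemannianMetric⟩
    IsSmoothForm (riemannianVolumeForm o) →
      cmcoderiv (fun u : U ↦ o u.1) h (fun u : U ↦ β u.1 : MForm 𝓘(ℝ, E) U ℂ (l + 1)) =
        fun u : U ↦ cmcoderiv o h β u.1 := by
  letI : RiemannianBundle (fun x : M ↦ TangentSpace 𝓘(ℝ, E) x) := ⟨g.toRiemannianMetric⟩
  letI : RiemannianBundle (fun u : U ↦ TangentSpace 𝓘(ℝ, E) u) :=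
    ⟨(restrictMetric g U).toRiemannianMetric⟩
  haveI : IsContMDiffRiemannianBundle 𝓘(ℝ, E) ∞ E (fun x : M ↦ TangentSpace 𝓘(ℝ, E) x) :=
    ⟨g.inner, g.contMDiff, fun _ _ _ ↦ rfl⟩
  intro ho
  unfold cmcoderiv
  rw [cHodgeStar_restrict g o U h β, mextDeriv_restrict U (IsSmoothForm.cHodgeStar o ho h hβ),
    cHodgeStar_restrict g o U _ (mextDeriv (MForm.cHodgeStar o h β))]
  rfl

/-- **`∂̄*` commutes with restriction** on smooth forms: `∂̄*(α|_U) = (∂̄*α)|_U` (`∂̄* = -⋆∂⋆`;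
Huybrechts (2005), Def. 3.1.3). [cite: Huybrechts2005, Def. 3.1.3] -/
theorem dolbeaultBarAdjoint_restrict {l l' : ℕ} (h : (l + 1) + l' = n)
    {β : MForm 𝓘(ℝ, E) M ℂ (l + 1)} (hβ : IsSmoothForm β) :
    letI : RiemannianBundle (fun x : M ↦ TangentSpace 𝓘(ℝ, E) x) := ⟨g.toRiemannianMetric⟩
    letI : RiemannianBundle (fun u : U ↦ TangentSpace 𝓘(ℝ, E) u) :=
      ⟨(restrictMetric g U).toRiemannianMetric⟩
    IsSmoothForm (riemannianVolumeForm o) →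
      dolbeaultBarAdjoint (fun u : U ↦ o u.1) h (fun u : U ↦ β u.1 : MForm 𝓘(ℝ, E) U ℂ (l + 1)) =
        fun u : U ↦ dolbeaultBarAdjoint o h β u.1 := by
  letI : RiemannianBundle (fun x : M ↦ TangentSpace 𝓘(ℝ, E) x) := ⟨g.toRiemannianMetric⟩
  letI : RiemannianBundle (fun u : U ↦ TangentSpace 𝓘(ℝ, E) u) :=
    ⟨(restrictMetric g U).toRiemannianMetric⟩
  haveI : IsContMDiffRiemannianBundle 𝓘(ℝ, E) ∞ E (fun x : M ↦ TangentSpace 𝓘(ℝ, E) x) :=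
    ⟨g.inner, g.contMDiff, fun _ _ _ ↦ rfl⟩
  intro ho
  unfold dolbeaultBarAdjoint
  rw [cHodgeStar_restrict g o U h β, dolbeault_restrict U (IsSmoothForm.cHodgeStar o ho h hβ),
    cHodgeStar_restrict g o U _ (dolbeault (MForm.cHodgeStar o h β))]
  rfl

omit [IsManifold 𝓘(ℂ, E) ω M] in
/-- **The Hodge–de Rham Laplacian commutes with restriction** on smooth forms:
`Δ_d(α|_U) = (Δ_d α)|_U` (smooth metric, orientation with smooth volume form; case by case on
the degree pattern `(k, m)` of `cHodgeLaplacian`). Warner (1983), 6.1, p. 220.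
[cite: WarnerGTM94, 6.1, p. 220] -/
theorem cHodgeLaplacian_restrict (h : k + m = n) {β : MForm 𝓘(ℝ, E) M ℂ k} (hβ : IsSmoothForm β) :
    letI : RiemannianBundle (fun x : M ↦ TangentSpace 𝓘(ℝ, E) x) := ⟨g.toRiemannianMetric⟩
    letI : RiemannianBundle (fun u : U ↦ TangentSpace 𝓘(ℝ, E) u) :=
      ⟨(restrictMetric g U).toRiemannianMetric⟩
    IsSmoothForm (riemannianVolumeForm o) →
      cHodgeLaplacian (fun u : U ↦ o u.1) k m h (fun u : U ↦ β u.1 : MForm 𝓘(ℝ, E) U ℂ k) =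
        fun u : U ↦ cHodgeLaplacian o k m h β u.1 := by
  letI : RiemannianBundle (fun x : M ↦ TangentSpace 𝓘(ℝ, E) x) := ⟨g.toRiemannianMetric⟩
  letI : RiemannianBundle (fun u : U ↦ TangentSpace 𝓘(ℝ, E) u) :=
    ⟨(restrictMetric g U).toRiemannianMetric⟩
  haveI : IsContMDiffRiemannianBundle 𝓘(ℝ, E) ∞ E (fun x : M ↦ TangentSpace 𝓘(ℝ, E) x) :=
    ⟨g.inner, g.contMDiff, fun _ _ _ ↦ rfl⟩
  intro ho
  rcases k with - | k <;> rcases m with - | m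
  · rfl
  · simp only [cHodgeLaplacian]
    rw [mextDeriv_restrict U hβ, cmcoderiv_restrict g o U _ hβ.mextDeriv ho]
  · simp only [cHodgeLaplacian]
    rw [cmcoderiv_restrict g o U _ hβ ho, mextDeriv_restrict U (IsSmoothForm.cmcoderiv o ho _ hβ)]
  · simp only [cHodgeLaplacian]
    rw [cmcoderiv_restrict g o U _ hβ ho, mextDeriv_restrict U (IsSmoothForm.cmcoderiv o ho _ hβ),
      mextDeriv_restrict U hβ, cmcoderiv_restrict g o U _ hβ.mextDeriv ho]
    rfl

/-- **The `∂̄`-Laplacian commutes with restriction** on smooth forms of a complex manifold: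
`Δ_∂̄(α|_U) = (Δ_∂̄ α)|_U` (case by case on the degree pattern of `dolbeaultLaplacian`).
Voisin (2002), §5.1.2. [cite: Voisin2002, §5.1.2] -/
theorem dolbeaultLaplacian_restrict (h : k + m = n) {β : MForm 𝓘(ℝ, E) M ℂ k}
    (hβ : IsSmoothForm β) :
    letI : RiemannianBundle (fun x : M ↦ TangentSpace 𝓘(ℝ, E) x) := ⟨g.toRiemannianMetric⟩
    letI : RiemannianBundle (fun u : U ↦ TangentSpace 𝓘(ℝ, E) u) :=
      ⟨(restrictMetric g U).toRiemannianMetric⟩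
    IsSmoothForm (riemannianVolumeForm o) →
      dolbeaultLaplacian (fun u : U ↦ o u.1) k m h (fun u : U ↦ β u.1 : MForm 𝓘(ℝ, E) U ℂ k) =
        fun u : U ↦ dolbeaultLaplacian o k m h β u.1 := by
  letI : RiemannianBundle (fun x : M ↦ TangentSpace 𝓘(ℝ, E) x) := ⟨g.toRiemannianMetric⟩
  letI : RiemannianBundle (fun u : U ↦ TangentSpace 𝓘(ℝ, E) u) :=
    ⟨(restrictMetric g U).toRiemannianMetric⟩
  haveI : IsContMDiffRiemannianBundle 𝓘(ℝ, E) ∞ E (fun x : M ↦ TangentSpace 𝓘(ℝ, E) x) :=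
    ⟨g.inner, g.contMDiff, fun _ _ _ ↦ rfl⟩
  intro ho
  rcases k with - | k <;> rcases m with - | m
  · rfl
  · simp only [dolbeaultLaplacian]
    rw [dolbeaultBar_restrict U hβ, dolbeaultBarAdjoint_restrict g o U _ hβ.dolbeaultBar ho]
  · simp only [dolbeaultLaplacian]
    rw [dolbeaultBarAdjoint_restrict g o U _ hβ ho,
      dolbeaultBar_restrict U (IsSmoothForm.dolbeaultBarAdjoint o ho _ hβ)]
  · simp only [dolbeaultLaplacian]
    rw [dolbeaultBarAdjoint_restrict g o U _ hβ ho,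
      dolbeaultBar_restrict U (IsSmoothForm.dolbeaultBarAdjoint o ho _ hβ), dolbeaultBar_restrict U hβ,
      dolbeaultBarAdjoint_restrict g o U _ hβ.dolbeaultBar ho]
    rfl

omit [FiniteDimensional ℂ E] [IsManifold 𝓘(ℂ, E) ω M] in
/-- **The Kähler form of the induced metric is the restriction of the Kähler form** (pointwise:
`ω_{g|_U} = ω_g|_U`; Voisin (2002), §3.1.1). [cite: Voisin2002, §3.1.1] -/
theorem kaehlerForm_restrict :
    (restrictMetric g U).toRiemannianMetric.kaehlerForm =
      fun u : U ↦ g.toRiemannianMetric.kaehlerForm u.1 :=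
  rfl

/-- **The induced metric of a Kähler metric is Kähler**: it is Hermitian pointwise, and
`d(ω|_U) = (dω)|_U = 0` (the Kähler form of a smooth metric is smooth, `d` is natural for the
inclusion). Voisin (2002), §3.1.2, Def. 3.6. [cite: Voisin2002, Def. 3.6] -/
theorem isKaehler_restrict (hg : g.toRiemannianMetric.IsKaehler) :
    (restrictMetric g U).toRiemannianMetric.IsKaehler := by
  refine ⟨fun u v w ↦ hg.1 u.1 v w, ?_⟩
  change mextDeriv (restrictMetric g U).toRiemannianMetric.kaehlerForm = 0
  rw [kaehlerForm_restrict g U,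
    mextDeriv_restrict U (isSmoothForm_kaehlerForm_of_isManifold_complex_holds g)]
  have h0 : mextDeriv g.toRiemannianMetric.kaehlerForm = 0 := hg.2
  funext u
  rw [h0]
  rfl

end Restrict

/-! ### The discharges -/

section Discharge

variable {E : Type*} [NormedAddCommGroup E] [NormedSpace ℂ E]
  {M : Type*} [TopologicalSpace M] [ChartedSpace E M] {k m : ℕ}
  [FiniteDimensional ℂ E] {n : ℕ} [Fact (finrank ℝ E = n)]
  [IsManifold 𝓘(ℂ, E) ω M] [IsManifold 𝓘(ℝ, E) ∞ M]
  (g : ContMDiffRiemannianMetric 𝓘(ℝ, E) ∞ E (fun x : M ↦ TangentSpace 𝓘(ℝ, E) x))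
  (o : (x : M) → Orientation ℝ (TangentSpace 𝓘(ℝ, E) x) (Fin n))

/-- **Discharge of the named fact `cHodgeLaplacian_eq_two_smul_dolbeaultLaplacian_of_isManifold_complex`
(`KaehlerHodge.lean`): the Kähler identity `Δ_d = 2Δ_∂̄`** on the smooth forms of any complex
manifold with a Kähler metric — Voisin (2002), §6.1.2, Thm. 6.7 ("Let `(X, ω)` be a Kähler manifold
… `Δ_∂ = Δ_∂̄ = ½ Δ_d`"); Huybrechts (2005), Prop. 3.1.12 (iii); Griffiths–Harris (1978), p. 115 —
for EVERY `M` (no separation axiom), all degrees. Proof: the identity is local; at `x ∈ M` restrict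
to the (Hausdorff) domain `U` of the chart at `x`, where the tree's
`cHodgeLaplacian_eq_two_smul_dolbeaultLaplacian_of_isManifold_complex_of_t2Space` (Voisin's proof:
Prop. 6.5 by osculation, then Thm. 6.7) applies to `g|_U`, `o|_U`, `α|_U`, and transport back by
`cHodgeLaplacian_restrict` / `dolbeaultLaplacian_restrict`. [cite: Voisin2002, §6.1.2 Thm. 6.7] -/
theorem cHodgeLaplacian_eq_two_smul_dolbeaultLaplacian_of_isManifold_complex_holds :
    cHodgeLaplacian_eq_two_smul_dolbeaultLaplacian_of_isManifold_complex (k := k) (m := m) g o := by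
  intro hg h α hα
  letI : RiemannianBundle (fun x : M ↦ TangentSpace 𝓘(ℝ, E) x) := ⟨g.toRiemannianMetric⟩
  intro ho
  funext x
  -- the Hausdorff open submanifold `U = (chartAt E x).source ∋ x`
  let U : Opens M := ⟨(chartAt E x).source, (chartAt E x).open_source⟩
  haveI : T2Space U := (chartAt E x).toHomeomorphSourceTarget.symm.t2Space
  letI : RiemannianBundle (fun u : U ↦ TangentSpace 𝓘(ℝ, E) u) :=
    ⟨(restrictMetric g U).toRiemannianMetric⟩
  have hαU : IsSmoothForm (I := 𝓘(ℝ, E)) (fun u : U ↦ α u.1 : MForm 𝓘(ℝ, E) U ℂ k) :=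
    isSmoothForm_restrict U hα
  have hoU : IsSmoothForm (riemannianVolumeForm (I := 𝓘(ℝ, E)) (fun u : U ↦ o u.1)) := by
    rw [riemannianVolumeForm_restrict g o U]
    exact isSmoothForm_restrict U ho
  have key := cHodgeLaplacian_eq_two_smul_dolbeaultLaplacian_of_isManifold_complex_of_t2Space
    (restrictMetric g U) (fun u : U ↦ o u.1) (isKaehler_restrict g U hg) h hαU hoU
  rw [cHodgeLaplacian_restrict g o U h hα ho, dolbeaultLaplacian_restrict g o U h hα ho] at key
  exact congrFun key ⟨x, mem_chart_source E x⟩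

end Discharge

/-! ### The corollaries, through the tree's glue theorems -/

section Corollaries

variable {E : Type*} [NormedAddCommGroup E] [NormedSpace ℂ E]
  {M : Type*} [TopologicalSpace M] [ChartedSpace E M]
  [FiniteDimensional ℂ E] {n : ℕ} [Fact (finrank ℝ E = n)]
  [IsManifold 𝓘(ℂ, E) ω M] [IsManifold 𝓘(ℝ, E) ∞ M]
  (g : ContMDiffRiemannianMetric 𝓘(ℝ, E) ∞ E (fun x : M ↦ TangentSpace 𝓘(ℝ, E) x))
  (o : (x : M) → Orientation ℝ (TangentSpace 𝓘(ℝ, E) x) (Fin n)) {k m : ℕ}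

/-- **Discharge of `dolbeaultLaplacian_eq_delLaplacian_of_isManifold_complex`: the Kähler identity
`Δ_∂̄ = Δ_∂`** (Voisin (2002), §6.1.2, Thm. 6.7; Huybrechts (2005), Prop. 3.1.12 (iii)), every
complex manifold, all degrees — the tree's glue
`dolbeaultLaplacian_eq_delLaplacian_of_isManifold_complex_of_cHodgeLaplacian_eq_two_smul` fed the
discharged `Δ_d = 2Δ_∂̄`. [cite: Voisin2002, §6.1.2 Thm. 6.7] -/
theorem dolbeaultLaplacian_eq_delLaplacian_of_isManifold_complex_holds :
    dolbeaultLaplacian_eq_delLaplacian_of_isManifold_complex (g := g) (o := o) (k := k) (m := m) :=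
  dolbeaultLaplacian_eq_delLaplacian_of_isManifold_complex_of_cHodgeLaplacian_eq_two_smul g o
    (cHodgeLaplacian_eq_two_smul_dolbeaultLaplacian_of_isManifold_complex_holds g o)

/-- **Discharge of `typeComponent_mem_charmonicForms_of_isManifold_complex`: the
`(p,q)`-components of a `Δ_d`-harmonic complex form on a Kähler manifold are `Δ_d`-harmonic**
(Voisin (2002), §6.1.2, Cor. 6.9), every complex manifold — the tree's
`typeComponent_mem_charmonicForms_of_isManifold_complex_of_kaehlerIdentity` fed the discharged
`Δ_d = 2Δ_∂̄`. [cite: Voisin2002, §6.1.2 Cor. 6.9] -/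
theorem typeComponent_mem_charmonicForms_of_isManifold_complex_holds :
    typeComponent_mem_charmonicForms_of_isManifold_complex (g := g) (o := o) (k := k) (m := m) :=
  typeComponent_mem_charmonicForms_of_isManifold_complex_of_kaehlerIdentity g o
    (cHodgeLaplacian_eq_two_smul_dolbeaultLaplacian_of_isManifold_complex_holds g o)

/-- **Discharge of `typeComponent_mem_harmonicForms_of_isManifold_complex`** (the real form of
Cor. 6.9: type components of harmonic forms are harmonic; Voisin (2002), §6.1.2, Cor. 6.9 with
Thm. 5.23), every complex manifold — the tree's `typeComponent_mem_harmonicForms_of_kaehlerIdentity`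
fed the discharged `Δ_d = 2Δ_∂̄`. [cite: Voisin2002, §6.1.2 Cor. 6.9] -/
theorem typeComponent_mem_harmonicForms_of_isManifold_complex_holds :
    typeComponent_mem_harmonicForms_of_isManifold_complex (g := g) (o := o) (k := k) (m := m) :=
  typeComponent_mem_harmonicForms_of_kaehlerIdentity g o
    (cHodgeLaplacian_eq_two_smul_dolbeaultLaplacian_of_isManifold_complex_holds g o)

/-- **Discharge of `dolbeaultHarmonicForms_le_charmonicForms_of_isManifold_complex`:
`ℋ^{p,q}_{∂̄} ≤ ℋᵏ_ℂ`** — on a Kähler manifold the `∂̄`-harmonic `(p,q)`-forms are `Δ_d`-harmonic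
(Voisin (2002), §6.1.2, remark after Cor. 6.10; Huybrechts (2005), Prop. 3.2.6), every complex
manifold — the tree's
`dolbeaultHarmonicForms_le_charmonicForms_of_isManifold_complex_of_kaehlerIdentity` fed the
discharged `Δ_d = 2Δ_∂̄`. [cite: Voisin2002, §6.1.2 Cor. 6.10] -/
theorem dolbeaultHarmonicForms_le_charmonicForms_of_isManifold_complex_holds :
    dolbeaultHarmonicForms_le_charmonicForms_of_isManifold_complex (g := g) (o := o) (k := k) (m := m) :=
  dolbeaultHarmonicForms_le_charmonicForms_of_isManifold_complex_of_kaehlerIdentity g o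
    (cHodgeLaplacian_eq_two_smul_dolbeaultLaplacian_of_isManifold_complex_holds g o)

/-- **Discharge of `dolbeaultHarmonicForms_conj_of_isManifold_complex`: complex conjugation maps
`ℋ^{p,q}_{∂̄}` onto `ℋ^{q,p}_{∂̄}` on a Kähler manifold** (Voisin (2002), §6.1.3, Cor. 6.12 with
Thm. 6.7 / Cor. 6.10; Huybrechts (2005), Rem. 3.2.7 (i)), every complex manifold — the tree's
`dolbeaultHarmonicForms_conj_of_isManifold_complex_of_cHodgeLaplacian_eq_two_smul` fed the
discharged `Δ_d = 2Δ_∂̄`. [cite: Voisin2002, §6.1.3 Cor. 6.12] -/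
theorem dolbeaultHarmonicForms_conj_of_isManifold_complex_holds :
    dolbeaultHarmonicForms_conj_of_isManifold_complex (g := g) (o := o) (k := k) (m := m) :=
  dolbeaultHarmonicForms_conj_of_isManifold_complex_of_cHodgeLaplacian_eq_two_smul g o
    (cHodgeLaplacian_eq_two_smul_dolbeaultLaplacian_of_isManifold_complex_holds g o)

/-- **The harmonic Hodge decomposition `ℋᵏ_ℂ = ⨆_{p+q=k} ℋ^{p,q}_{∂̄}`** of the `Δ_d`-harmonic complex
forms of a Kähler metric (the predicate `charmonicForms_eq_iSup_dolbeaultHarmonicForms g o` of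
`KaehlerHodge.lean`; Voisin (2002), §6.1.2, Cor. 6.10; Huybrechts (2005), Prop. 3.2.6 (ii)), on
every complex manifold — the tree's `charmonicForms_eq_iSup_dolbeaultHarmonicForms_of_kaehlerIdentity`
fed the discharged `Δ_d = 2Δ_∂̄` (stated with the complex-manifold instances in scope, as that
predicate binds no atlas). [cite: Voisin2002, §6.1.2 Cor. 6.10] -/
theorem charmonicForms_eq_iSup_dolbeaultHarmonicForms_of_isManifold_complex :
    charmonicForms_eq_iSup_dolbeaultHarmonicForms (g := g) (o := o) (k := k) (m := m) :=
  charmonicForms_eq_iSup_dolbeaultHarmonicForms_of_kaehlerIdentity g o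
    (cHodgeLaplacian_eq_two_smul_dolbeaultLaplacian_of_isManifold_complex_holds g o)

end Corollaries

end Literature.NumberTheory.Transcendental
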